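import Summits.CriticalPhenomena.PercolationContinuityZ3.Theorems.PercNearOneGluingNoHeavyLowerTailQuantitativeHarrisInfluenceFloor
import HarnessLib

/-!
# The level-0 CSH transfer (K6) for relay sets with the SIZE-FREE, COMPLETE influence-product floor

Support file (`--supports stmt-CriticalPhenomena-4575`), prover seat `prim-rate-mine-2` (lane prim-rate, constants-miner (c), BENCH rows
M2-R17 / M2-R5; `run/shared/lean/prim/prim-rate/prim-rate-mine-2/CANDIDATES.md` §gen-4).  No definitions, no named facts, no sorries; standard axioms.

`CSH.covTransfer_relaySet_edge_explicitFloor` (row M2-R5, kernel) floors the Harris term of the (K6) transfer — paper Lemma 3.8 for a relay SET `S`,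
`x ∈ S`, a monotone nonnegative functional `g` of the open edge cluster of `x` — by `|E|⁻¹·Σ_e w_e(1−w_e)·E[Δ_e g(𝒞_x)·Δ_e 1_U]` (joint pivotality,
box-size constant `1/|E|`).  THIS FILE gives the companion floor with NO size constant, from the influence-product floor of row M2-R17
(`QuantHarris.influence_mul_influence_le_cov_prodBernoulli`): for EVERY pair `e`, with `D = {v ↮ S}`, `U = {o ↔ S} ∪ {o ↔ v}`, `m = ∫ g(𝒞_x)`,

  `μ(D ∩ {o↔v})·(∫_{v↔S} g(𝒞_x) − μ(v↔S)·m) + μ(D)·w_e(1−w_e)·(∫ Δ_e g(𝒞_x) dμ)·μ{e pivotal for U} ≤ μ(D)·(∫_{o↔S} g(𝒞_x) − μ(o↔S)·m)`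

(`CSH.covTransfer_relaySet_edge_influenceFloor`).  For connection functionals `g = 1{b ∈ ·}` and `S = {x}` this is the floor
`QuantBHK.level0Margin_ge_influenceFloor`, which is COMPLETE (positive for some `e` iff the margin is, row M2-R18).
[cite: VandenbergHaggstromKahn2005, Thm. 1.4 (p. 7)] [cite: Harris1960, Lemma 4.1 (p. 16)] [cite: Talagrand1996, Thm. 1.1 (p. 244)]
-/

noncomputable section

namespace Summit.CriticalPhenomena.PercolationContinuityZ3.Theorems

open MeasureTheory Set Literature.Probability.LatticeModels Literature.Probability.Percolation
open Literature.Probability.Percolation.BHK2006 (openEdgeCluster_mono)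
open scoped Classical

namespace CSH

variable {V : Type*} [Fintype V]

/-- **(K6) for a relay set with the size-free influence-product floor.**  `x ∈ S`, `g` monotone nonnegative on edge sets, `m = ∫ g(𝒞_x)`,
`D = {v ↮ S}`, `U = {o ↔ S} ∪ {o ↔ v}`; for every pair `e`:
`μ(D ∩ {o↔v})·(∫_{v↔S} g(𝒞_x) − μ(v↔S)·m) + μ(D)·(w_e(1−w_e)·(∫ (g(𝒞_x(ω∪e)) − g(𝒞_x(ω∖e))) dμ)·μ{ω : ω∪e ∈ U, ω∖e ∉ U}) ≤ μ(D)·(∫_{o↔S} g(𝒞_x) − μ(o↔S)·m)`.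
((K6) with its Harris term kept, `covTransfer_relaySet_edge_harrisFloor`, and the Harris term floored by row M2-R17; no `|E|`.)
[cite: VandenbergHaggstromKahn2005, Thm. 1.4 (p. 7)] [cite: Harris1960, Lemma 4.1 (p. 16)] -/
theorem covTransfer_relaySet_edge_influenceFloor (w : Sym2 V → unitInterval) (S : Finset V) (o v x : V) (hxS : x ∈ S)
    (g : Set (Sym2 V) → ℝ) (hg : Monotone g) (hg0 : ∀ C, 0 ≤ g C) (e : Sym2 V) :
    (prodBernoulli w).real ({ω : BondConfig V | ∀ t ∈ S, ¬ (openGraph ω).Reachable v t} ∩ openConn o v) *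
          (∫ ω in (⋃ t ∈ S, openConn v t), g (openEdgeCluster ω x) ∂(prodBernoulli w) -
            (prodBernoulli w).real (⋃ t ∈ S, openConn v t) * ∫ ω, g (openEdgeCluster ω x) ∂(prodBernoulli w)) +
        (prodBernoulli w).real {ω : BondConfig V | ∀ t ∈ S, ¬ (openGraph ω).Reachable v t} *
          ((w e : ℝ) * (1 - w e) *
            ((∫ ω, (g (openEdgeCluster (insert e ω) x) - g (openEdgeCluster (ω \ {e}) x)) ∂(prodBernoulli w)) *
              (prodBernoulli w).real {ω : BondConfig V | insert e ω ∈ ((⋃ t ∈ S, openConn o t) ∪ openConn o v : Set (BondConfig V)) ∧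
                ω \ {e} ∉ ((⋃ t ∈ S, openConn o t) ∪ openConn o v : Set (BondConfig V))})) ≤
      (prodBernoulli w).real {ω : BondConfig V | ∀ t ∈ S, ¬ (openGraph ω).Reachable v t} *
        (∫ ω in (⋃ t ∈ S, openConn o t), g (openEdgeCluster ω x) ∂(prodBernoulli w) -
          (prodBernoulli w).real (⋃ t ∈ S, openConn o t) * ∫ ω, g (openEdgeCluster ω x) ∂(prodBernoulli w)) := by
  set μ := prodBernoulli w with hμ
  set U : Set (BondConfig V) := (⋃ t ∈ S, openConn o t) ∪ openConn o v with hU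
  set D : Set (BondConfig V) := {ω | ∀ t ∈ S, ¬ (openGraph ω).Reachable v t} with hD
  have hmeas : ∀ T : Set (BondConfig V), MeasurableSet T := fun _ => MeasurableSet.of_discrete
  have hK6 := covTransfer_relaySet_edge_harrisFloor w S o v x hxS g hg
  have hUup : ∀ ω ω' : BondConfig V, ω ⊆ ω' → ω ∈ U → ω' ∈ U := by
    rintro ω ω' hle (h | h)
    · obtain ⟨t, ht, h⟩ := Set.mem_iUnion₂.1 h
      exact Or.inl (Set.mem_iUnion₂.2 ⟨t, ht, SimpleGraph.Reachable.mono (BHK2006.openGraph_le hle) h⟩)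
    · exact Or.inr (SimpleGraph.Reachable.mono (BHK2006.openGraph_le hle) h)
  have hH := QuantHarris.influence_mul_influence_le_cov_prodBernoulli w e (fun ω => g (openEdgeCluster ω x))
    (U.indicator fun _ => (1 : ℝ)) (fun _ => hg0 _) (fun ω => indicator_nonneg (fun _ _ => zero_le_one) ω)
    (fun _ _ h => hg (openEdgeCluster_mono h x)) (QuantHarris.indicator_upset_monotone hUup)
  simp only [QuantHarris.indicator_insert_sub_indicator_diff hUup] at hH
  have hprod : (fun ω => g (openEdgeCluster ω x) * U.indicator (fun _ => (1 : ℝ)) ω) =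
      U.indicator (fun ω => g (openEdgeCluster ω x)) := by
    funext ω
    by_cases h : ω ∈ U
    · rw [indicator_of_mem h, indicator_of_mem h, mul_one]
    · rw [indicator_of_notMem h, indicator_of_notMem h, mul_zero]
  rw [hprod, integral_indicator (hmeas U), integral_indicator (hmeas _), integral_indicator (hmeas _)] at hH
  simp only [integral_const, smul_eq_mul, mul_one, measureReal_restrict_apply_univ] at hH
  have hDn : 0 ≤ μ.real D := measureReal_nonneg
  have hmul := mul_le_mul_of_nonneg_left hH hDn
  linarith [hK6, hmul]

end CSH

end Summit.CriticalPhenomena.PercolationContinuityZ3.Theorems
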